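import Summits.QuantumFields.YangMills.Theorems.BalabanLadderIRColdPurityBridgeRungs
import Literature.MathematicalPhysics.QuantumFieldTheory.PeriodicBoxFreeEnergyLimits
import Literature.MathematicalPhysics.QuantumFieldTheory.WilsonFinTorusPartitionComplex
import HarnessLib

/-!
# Crux `IR` (stmt-QuantumFields-19354) — the purity defect is UNIFORMLY LIPSCHITZ in the coupling on the strong-coupling window
# (the RUNG of line `lipschitz-chain`'s structural stub LIP, by complex coupling: Kotecký–Preiss tube rate + Cauchy estimate)

HONEST FRAMING.  Nothing here proves the Yang–Mills mass gap (Clay), a lattice gap, the crux `BalabanLadder.IR` or its seed; `R4` closes only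
the conditional finite-𝕋⁴ rung `BalabanLadder.UV`.  This file is sorry-free, definition-free, GROUP-BLIND calculus on the STRONG-COUPLING WINDOW
`0 ≤ β < r_ρ = strongCouplingRadius ρ` (helper for item 19354, ideator ym-ir-idea-12, lens «wuc», line `lipschitz-chain`: the rung of its stub
`DefectLipschitzSC`, which asks the same conclusion on compact windows BEYOND some `β₁`).

CONTENT (namespace `Summit.QuantumFields.YangMills.Cruxes.IR.CouplingAxis`, `r : LatticeRep G`, `δᶜ_β(L) = ColdPurityBridge.coldDefect r.ρ β L`):
* `exists_uniform_coldRatioC_bound` — there is `L₁ ≥ 8` such that for every `L ≥ L₁` and every COMPLEX coupling `‖z‖ ≤ r_ρ` the complex Wilson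
  partition functions of the cold box pair satisfy `Z_z(L³×⌊L/4⌋) ≠ 0` and `‖Z_z(L³×2⌊L/4⌋) / Z_z(L³×⌊L/4⌋)²‖ ≤ e`: the tree's complex
  Kotecký–Preiss TUBE RATE `‖log Z_z(L³×t) − t·e_L(z)‖ ≤ 12 L³ t e^{−⌊t/2⌋}` (`exists_tube_rate`, uniform on the disc) makes
  `log Z(2m) − 2 log Z(m)` exponentially small in `m = ⌊L/4⌋`, uniformly in `z` (`tube_errors_eventually_le_one`).
* `coldDefect_lipschitz_strongCoupling` — for `0 ≤ u ≤ v < r_ρ`, all `L ≥ L₁` and all `b, b' ∈ [u, v]`: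
  `|δᶜ_b(L) − δᶜ_{b'}(L)| ≤ (1 + e)/(r_ρ − v) · |b − b'|` — UNIFORMLY IN THE VOLUME.  Proof: `z ↦ 1 − Z_z(2m)/Z_z(m)²` is holomorphic on the
  closed disc of radius `η = r_ρ − v` around each `b ∈ [u, v]` (inside the Kotecký–Preiss disc) and bounded there by `1 + e`; the CAUCHY ESTIMATE
  (`Complex.norm_deriv_le_of_forall_mem_sphere_norm_le`) bounds the derivative by `(1+e)/η`; the real restriction is `δᶜ_·(L)`
  (`wilsonFinTorusPartitionC_ofReal`); the mean value inequality (`Convex.norm_image_sub_le_of_norm_hasDerivWithin_le`) concludes.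
* `defectLipschitz_strongCoupling` — the same in the exact window shape of the stub `DefectLipschitzSC` of `Cruxes/IR/Lines/lipschitz_chain.lean`.
READING.  LIP (tail-uniform Lipschitz modulus of `β ↦ δᶜ_β(L)` beyond `β₁`) is thus «the strong-coupling regularity of the purity defect, continued
past `β₁`»; on the window it comes for free from analyticity in the COMPLEX coupling — a zero-free Kotecký–Preiss disc — which is exactly what is not
known at weak coupling (Fisher zeros of the deconfinement transition of the `4:1` tori approach the real axis).

Sources: tree `PeriodicBoxFreeEnergyLimits.exists_tube_rate`, `PlaqSystem.exp_pertLogZ_eq_partZ`, `boxSystem_regular`, `disc_hypotheses`,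
`boxSystem_partZ_univ_eq_finTorus`, `wilsonFinTorusPartitionC_ofReal`, `differentiable_wilsonFinTorusPartitionC`,
`Balaban1983to89.Missing.strongCouplingRadius_mul_costBound_le_one / _smallness / _pos`; Mathlib `Complex.norm_deriv_le_of_forall_mem_sphere_norm_le`,
`Convex.norm_image_sub_le_of_norm_hasDerivWithin_le`; KoteckyPreiss1986; SeilerLNP1982 Ch. 3; OsterwalderSeilerAnnPhys1978.
-/

set_option autoImplicit false

noncomputable section

open Filter Topology MeasureTheory Metric Set
open Literature.Probability.LatticeModels Literature.MathematicalPhysics.QuantumFieldTheory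
open Literature.MathematicalPhysics.QuantumFieldTheory.Balaban1983to89.Missing (strongCouplingRadius
  strongCouplingRadius_mul_costBound_le_one strongCouplingRadius_smallness strongCouplingRadius_pos)
open Summit.QuantumFields.YangMills.Cruxes.IR.ColdPurityBridge (coldDefect)

namespace Summit.QuantumFields.YangMills.Cruxes.IR.CouplingAxis

/-! ## §1 Scalar bookkeeping: the two tube errors of the cold box pair are eventually `≤ 1` -/

/-- The sum of the tube errors of the boxes `L³ × 2m` and (twice) `L³ × m`, `m = ⌊L/4⌋`, is at most `49152 (j+1)⁴ e^{−j}`, `j = ⌊m/2⌋`. -/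
theorem tube_errors_le (L : ℕ) :
    12 * (L : ℝ) ^ 3 * ((2 * (L / 4) : ℕ) : ℝ) * Real.exp (-((2 * (L / 4) / 2 : ℕ) : ℝ)) +
        2 * (12 * (L : ℝ) ^ 3 * ((L / 4 : ℕ) : ℝ) * Real.exp (-((L / 4 / 2 : ℕ) : ℝ))) ≤
      49152 * (((L / 4 / 2 : ℕ) : ℝ) + 1) ^ 4 * Real.exp (-((L / 4 / 2 : ℕ) : ℝ)) := by
  set m : ℕ := L / 4 with hm
  set j : ℕ := m / 2 with hj
  have h2m : 2 * m / 2 = m := by omega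
  rw [h2m]
  have hL : (L : ℝ) ≤ 4 * ((m : ℝ) + 1) := by
    have : L < 4 * (m + 1) := by omega
    exact_mod_cast this.le
  have hmj : (m : ℝ) + 1 ≤ 2 * ((j : ℝ) + 1) := by
    have : m + 1 ≤ 2 * (j + 1) := by omega
    exact_mod_cast this
  have hL0 : (0 : ℝ) ≤ L := by positivity
  have hm0 : (0 : ℝ) ≤ m := by positivity
  have hj0 : (0 : ℝ) ≤ j := by positivity
  have hexp : Real.exp (-(m : ℝ)) ≤ Real.exp (-(j : ℝ)) := by
    apply Real.exp_le_exp.2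
    have : j ≤ m := by omega
    have : (j : ℝ) ≤ m := by exact_mod_cast this
    linarith
  have hE0 : 0 ≤ Real.exp (-(j : ℝ)) := (Real.exp_pos _).le
  have hL3 : (L : ℝ) ^ 3 ≤ (4 * ((m : ℝ) + 1)) ^ 3 := by gcongr
  have hm1 : (m : ℝ) ≤ (m : ℝ) + 1 := by linarith
  have hM4 : ((m : ℝ) + 1) ^ 4 ≤ (2 * ((j : ℝ) + 1)) ^ 4 := by gcongr
  have h2mcast : ((2 * m : ℕ) : ℝ) = 2 * (m : ℝ) := by push_cast; ring
  rw [h2mcast]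
  -- first term
  have h1 : 12 * (L : ℝ) ^ 3 * (2 * (m : ℝ)) * Real.exp (-(m : ℝ)) ≤
      1536 * ((m : ℝ) + 1) ^ 4 * Real.exp (-(j : ℝ)) := by
    calc 12 * (L : ℝ) ^ 3 * (2 * (m : ℝ)) * Real.exp (-(m : ℝ))
        ≤ 12 * (4 * ((m : ℝ) + 1)) ^ 3 * (2 * ((m : ℝ) + 1)) * Real.exp (-(j : ℝ)) := by
          gcongr
      _ = 1536 * ((m : ℝ) + 1) ^ 4 * Real.exp (-(j : ℝ)) := by ring
  -- second term
  have h2 : 2 * (12 * (L : ℝ) ^ 3 * (m : ℝ) * Real.exp (-(j : ℝ))) ≤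
      1536 * ((m : ℝ) + 1) ^ 4 * Real.exp (-(j : ℝ)) := by
    calc 2 * (12 * (L : ℝ) ^ 3 * (m : ℝ) * Real.exp (-(j : ℝ)))
        ≤ 2 * (12 * (4 * ((m : ℝ) + 1)) ^ 3 * ((m : ℝ) + 1) * Real.exp (-(j : ℝ))) := by gcongr
      _ = 1536 * ((m : ℝ) + 1) ^ 4 * Real.exp (-(j : ℝ)) := by ring
  calc _ ≤ 1536 * ((m : ℝ) + 1) ^ 4 * Real.exp (-(j : ℝ)) + 1536 * ((m : ℝ) + 1) ^ 4 * Real.exp (-(j : ℝ)) :=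
        add_le_add h1 h2
    _ = 3072 * ((m : ℝ) + 1) ^ 4 * Real.exp (-(j : ℝ)) := by ring
    _ ≤ 3072 * (2 * ((j : ℝ) + 1)) ^ 4 * Real.exp (-(j : ℝ)) := by gcongr
    _ = 49152 * ((j : ℝ) + 1) ^ 4 * Real.exp (-(j : ℝ)) := by ring

/-- The majorant `49152 (j+1)⁴ e^{−j}` tends to zero. -/
theorem tendsto_tube_majorant :
    Tendsto (fun j : ℕ => 49152 * ((j : ℝ) + 1) ^ 4 * Real.exp (-(j : ℝ))) atTop (𝓝 0) := by
  have h1 : Tendsto (fun x : ℝ => x ^ 4 * Real.exp (-x)) atTop (𝓝 0) :=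
    Real.tendsto_pow_mul_exp_neg_atTop_nhds_zero 4
  have h2 : Tendsto (fun j : ℕ => ((j : ℝ) + 1)) atTop atTop :=
    tendsto_natCast_atTop_atTop.atTop_add tendsto_const_nhds
  have h3 := ((h1.comp h2).const_mul (49152 * Real.exp 1))
  rw [mul_zero] at h3
  refine h3.congr fun j => ?_
  simp only [Function.comp]
  have : Real.exp (-(j : ℝ)) = Real.exp 1 * Real.exp (-((j : ℝ) + 1)) := by
    rw [← Real.exp_add]; congr 1; ring
  rw [this]; ring

/-- **Eventually the two tube errors sum to at most `1`.** -/
theorem tube_errors_eventually_le_one :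
    ∃ L₁ : ℕ, 8 ≤ L₁ ∧ ∀ L : ℕ, L₁ ≤ L →
      12 * (L : ℝ) ^ 3 * ((2 * (L / 4) : ℕ) : ℝ) * Real.exp (-((2 * (L / 4) / 2 : ℕ) : ℝ)) +
          2 * (12 * (L : ℝ) ^ 3 * ((L / 4 : ℕ) : ℝ) * Real.exp (-((L / 4 / 2 : ℕ) : ℝ))) ≤ 1 := by
  obtain ⟨j₁, hj₁⟩ := eventually_atTop.1 ((tendsto_order.1 tendsto_tube_majorant).2 1 one_pos)
  refine ⟨8 * (j₁ + 1), by omega, fun L hL => ?_⟩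
  have hj : j₁ ≤ L / 4 / 2 := by omega
  exact (tube_errors_le L).trans (hj₁ _ hj).le

/-! ## §2 The complex cold ratio is zero-free and bounded by `e` on the Kotecký–Preiss disc, uniformly in the volume -/

section Complex

variable {G : Type} [Group G] [TopologicalSpace G] [IsTopologicalGroup G] [CompactSpace G]
  [MeasurableSpace G] [BorelSpace G]

/-- The box plaquette system's partition function at complex coupling IS the complex Wilson torus partition function
(`boxSystem_partZ_univ_eq_finTorus`, definitional unfolding of `wilsonFinTorusPartitionC`). -/
theorem boxSystem_partZ_eq_wilsonFinTorusPartitionC {N : ℕ} (ρ : G →* Matrix (Fin N) (Fin N) ℂ) (hρ : Continuous ρ)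
    (a t : ℕ) (z : ℂ) :
    (boxSystem (G := G) ρ (![a, a, a, t] : Fin 4 → ℕ)).partZ Finset.univ z = wilsonFinTorusPartitionC ρ z a a a t := by
  rw [boxSystem_partZ_univ_eq_finTorus ρ hρ]
  rfl

/-- **Uniform complex control of the cold box pair on the strong-coupling disc.**  There is `L₁ ≥ 8` (depending on nothing but the
numerics of the tube errors) such that for every `L ≥ L₁` and every `‖z‖ ≤ r_ρ`: `Z_z(L³×⌊L/4⌋) ≠ 0` and
`‖Z_z(L³×2⌊L/4⌋) / Z_z(L³×⌊L/4⌋)²‖ ≤ e`. -/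
theorem exists_uniform_coldRatioC_bound (r : LatticeRep G) :
    ∃ L₁ : ℕ, 8 ≤ L₁ ∧ ∀ L : ℕ, L₁ ≤ L → ∀ z : ℂ, ‖z‖ ≤ strongCouplingRadius r.ρ →
      wilsonFinTorusPartitionC r.ρ z L L L (L / 4) ≠ 0 ∧
        ‖wilsonFinTorusPartitionC r.ρ z L L L (2 * (L / 4)) / wilsonFinTorusPartitionC r.ρ z L L L (L / 4) ^ 2‖ ≤
          Real.exp 1 := by
  obtain ⟨L₁, hL₁8, hL₁⟩ := tube_errors_eventually_le_one
  refine ⟨L₁, hL₁8, fun L hL z hz => ?_⟩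
  have hM := costBound_pos r.ρ
  have hrM := strongCouplingRadius_mul_costBound_le_one r.ρ
  have hr2 := strongCouplingRadius_smallness r.ρ
  have hLpos : 0 < L := by omega
  have hm1 : 1 ≤ L / 4 := by omega
  obtain ⟨e, he⟩ := exists_tube_rate (G := G) r.continuous hrM hr2 (a := L) hLpos
  obtain ⟨hzM, -, hz1⟩ := disc_hypotheses (D := boxDeg 4) hM hrM hr2 hz
  -- the Kotecký–Preiss logarithms of the two boxes
  set m : ℕ := L / 4 with hmdef
  set ℓ₁ : ℂ := pertLogZ (zdHaar 4 G) ((boxSystem (G := G) r.ρ (![L, L, L, m] : Fin 4 → ℕ)).weight z)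
      (boxSystem (G := G) r.ρ (![L, L, L, m] : Fin 4 → ℕ)).Adj Finset.univ with hℓ₁
  set ℓ₂ : ℂ := pertLogZ (zdHaar 4 G) ((boxSystem (G := G) r.ρ (![L, L, L, 2 * m] : Fin 4 → ℕ)).weight z)
      (boxSystem (G := G) r.ρ (![L, L, L, 2 * m] : Fin 4 → ℕ)).Adj Finset.univ with hℓ₂
  have hZ₁ : Complex.exp ℓ₁ = wilsonFinTorusPartitionC r.ρ z L L L m := by
    rw [hℓ₁, PlaqSystem.exp_pertLogZ_eq_partZ (boxSystem_regular (d := 4) (G := G) r.ρ r.continuous _) hzM hz1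
      Finset.univ, boxSystem_partZ_eq_wilsonFinTorusPartitionC r.ρ r.continuous]
  have hZ₂ : Complex.exp ℓ₂ = wilsonFinTorusPartitionC r.ρ z L L L (2 * m) := by
    rw [hℓ₂, PlaqSystem.exp_pertLogZ_eq_partZ (boxSystem_regular (d := 4) (G := G) r.ρ r.continuous _) hzM hz1
      Finset.univ, boxSystem_partZ_eq_wilsonFinTorusPartitionC r.ρ r.continuous]
  have hb₁ := he m hm1 z hz
  have hb₂ := he (2 * m) (by omega) z hz
  rw [← hℓ₁] at hb₁
  rw [← hℓ₂] at hb₂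
  -- the difference of logarithms is small
  have hdiff : ‖ℓ₂ - 2 * ℓ₁‖ ≤ 1 := by
    have hid : ℓ₂ - 2 * ℓ₁ = (ℓ₂ - ((2 * m : ℕ) : ℂ) * e z) - 2 * (ℓ₁ - (m : ℂ) * e z) := by
      push_cast; ring
    rw [hid]
    calc ‖(ℓ₂ - ((2 * m : ℕ) : ℂ) * e z) - 2 * (ℓ₁ - (m : ℂ) * e z)‖
        ≤ ‖ℓ₂ - ((2 * m : ℕ) : ℂ) * e z‖ + ‖2 * (ℓ₁ - (m : ℂ) * e z)‖ := norm_sub_le _ _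
      _ = ‖ℓ₂ - ((2 * m : ℕ) : ℂ) * e z‖ + 2 * ‖ℓ₁ - (m : ℂ) * e z‖ := by
          rw [norm_mul, Complex.norm_ofNat]
      _ ≤ 12 * (L : ℝ) ^ 3 * ((2 * m : ℕ) : ℝ) * Real.exp (-((2 * m / 2 : ℕ) : ℝ)) +
            2 * (12 * (L : ℝ) ^ 3 * (m : ℝ) * Real.exp (-((m / 2 : ℕ) : ℝ))) := by
          gcongr
      _ ≤ 1 := hL₁ L hL
  have hne : wilsonFinTorusPartitionC r.ρ z L L L m ≠ 0 := by
    rw [← hZ₁]; exact Complex.exp_ne_zero _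
  refine ⟨hne, ?_⟩
  have hratio : wilsonFinTorusPartitionC r.ρ z L L L (2 * m) / wilsonFinTorusPartitionC r.ρ z L L L m ^ 2 =
      Complex.exp (ℓ₂ - 2 * ℓ₁) := by
    rw [← hZ₁, ← hZ₂, Complex.exp_sub, two_mul, Complex.exp_add, sq]
  rw [hratio, Complex.norm_exp]
  exact Real.exp_le_exp.2 ((Complex.re_le_norm _).trans hdiff)

/-! ## §3 The Cauchy estimate: `β ↦ δᶜ_β(L)` is `(1+e)/(r_ρ − v)`-Lipschitz on `[u, v] ⊂ [0, r_ρ)`, uniformly in `L ≥ L₁` -/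

/-- **RUNG of LIP (PROVED, group-blind, uniform in the volume).**  For `0 ≤ u ≤ v < r_ρ`, every `L ≥ L₁(ρ)` and all `b, b' ∈ [u, v]`:
`|δᶜ_b(L) − δᶜ_{b'}(L)| ≤ (1 + e)/(r_ρ − v) · |b − b'|`. -/
theorem coldDefect_lipschitz_strongCoupling (r : LatticeRep G) :
    ∃ L₁ : ℕ, 8 ≤ L₁ ∧ ∀ u v : ℝ, 0 ≤ u → u ≤ v → v < strongCouplingRadius r.ρ →
      ∀ L : ℕ, L₁ ≤ L → ∀ b b' : ℝ, u ≤ b → b ≤ v → u ≤ b' → b' ≤ v →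
        |coldDefect r.ρ b L - coldDefect r.ρ b' L| ≤
          (1 + Real.exp 1) / (strongCouplingRadius r.ρ - v) * |b - b'| := by
  haveI : SecondCountableTopology G :=
    (r.continuous.isClosedEmbedding r.injective).isEmbedding.secondCountableTopology
  obtain ⟨L₁, hL₁8, hL₁⟩ := exists_uniform_coldRatioC_bound r
  refine ⟨L₁, hL₁8, fun u v hu huv hv L hL b b' hub hbv hub' hb'v => ?_⟩
  set rr : ℝ := strongCouplingRadius r.ρ with hrr
  set η : ℝ := rr - v with hη
  have hη0 : 0 < η := by rw [hη]; linarith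
  set m : ℕ := L / 4 with hm
  -- the holomorphic function whose real restriction is the cold defect
  set h : ℂ → ℂ := fun z =>
    1 - wilsonFinTorusPartitionC r.ρ z L L L (2 * m) / wilsonFinTorusPartitionC r.ρ z L L L m ^ 2 with hh
  have hF := differentiable_wilsonFinTorusPartitionC r.ρ r.continuous L L L (2 * m)
  have hG := differentiable_wilsonFinTorusPartitionC r.ρ r.continuous L L L m
  -- points of the closed `η`-disc around a point of `[u, v]` lie in the Kotecký–Preiss disc
  have hdisc : ∀ x : ℝ, u ≤ x → x ≤ v → ∀ z : ℂ, dist z (x : ℂ) ≤ η → ‖z‖ ≤ rr := by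
    intro x hux hxv z hz
    have hx0 : 0 ≤ x := hu.trans hux
    have h1 : ‖z‖ ≤ ‖z - (x : ℂ)‖ + ‖(x : ℂ)‖ := by
      have := norm_add_le (z - (x : ℂ)) (x : ℂ)
      rwa [sub_add_cancel] at this
    rw [dist_eq_norm] at hz
    rw [Complex.norm_real, Real.norm_eq_abs, abs_of_nonneg hx0] at h1
    linarith
  have hdiffAt : ∀ z : ℂ, ‖z‖ ≤ rr → DifferentiableAt ℂ h z := by
    intro z hz
    have hne := (hL₁ L hL z hz).1
    exact ((hF z).div ((hG z).pow 2) (pow_ne_zero 2 hne)).const_sub 1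
  have hbound : ∀ z : ℂ, ‖z‖ ≤ rr → ‖h z‖ ≤ 1 + Real.exp 1 := by
    intro z hz
    have hb := (hL₁ L hL z hz).2
    calc ‖h z‖ ≤ ‖(1 : ℂ)‖ + ‖wilsonFinTorusPartitionC r.ρ z L L L (2 * m) / wilsonFinTorusPartitionC r.ρ z L L L m ^ 2‖ :=
          norm_sub_le _ _
      _ ≤ 1 + Real.exp 1 := by rw [norm_one]; exact add_le_add le_rfl hb
  -- Cauchy estimate at every point of `[u, v]`
  have hderiv : ∀ x : ℝ, u ≤ x → x ≤ v → ‖deriv h (x : ℂ)‖ ≤ (1 + Real.exp 1) / η := by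
    intro x hux hxv
    refine Complex.norm_deriv_le_of_forall_mem_sphere_norm_le hη0 ?_ ?_
    · refine DifferentiableOn.diffContOnCl ?_
      intro z hz
      rw [closure_ball _ hη0.ne'] at hz
      exact (hdiffAt z (hdisc x hux hxv z (mem_closedBall.1 hz))).differentiableWithinAt
    · intro z hz
      exact hbound z (hdisc x hux hxv z (mem_sphere.1 hz).le)
  -- the real restriction of `h` is the cold defect
  have hreal : ∀ y : ℝ, (h (y : ℂ)).re = coldDefect r.ρ y L := by
    intro y
    simp only [hh, wilsonFinTorusPartitionC_ofReal]
    rw [← Complex.ofReal_pow, ← Complex.ofReal_div, ← Complex.ofReal_one, ← Complex.ofReal_sub, Complex.ofReal_re]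
    rfl
  -- real derivative and its bound
  have hHas : ∀ x : ℝ, u ≤ x → x ≤ v →
      HasDerivAt (fun y : ℝ => coldDefect r.ρ y L) ((deriv h (x : ℂ)).re) x := by
    intro x hux hxv
    have hx : ‖(x : ℂ)‖ ≤ rr := hdisc x hux hxv (x : ℂ) (by rw [dist_self]; exact hη0.le)
    have h1 : HasDerivAt h (deriv h (x : ℂ)) (x : ℂ) := (hdiffAt _ hx).hasDerivAt
    have h2 : HasDerivAt (fun y : ℝ => h (y : ℂ)) (deriv h (x : ℂ)) x := h1.comp_ofReal
    have h3 := (Complex.reCLM.hasFDerivAt.comp_hasDerivAt x h2)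
    have h4 : (⇑Complex.reCLM ∘ fun y : ℝ => h (y : ℂ)) = fun y : ℝ => coldDefect r.ρ y L := by
      funext y; simp only [Function.comp, Complex.reCLM_apply]; exact hreal y
    rw [h4] at h3
    simpa only [Complex.reCLM_apply] using h3
  have hMVT := Convex.norm_image_sub_le_of_norm_hasDerivWithin_le
    (f := fun y : ℝ => coldDefect r.ρ y L) (f' := fun x : ℝ => (deriv h (x : ℂ)).re) (s := Icc u v)
    (C := (1 + Real.exp 1) / η)
    (fun x hx => (hHas x hx.1 hx.2).hasDerivWithinAt)
    (fun x hx => (Complex.abs_re_le_norm _).trans (by simpa [Real.norm_eq_abs] using hderiv x hx.1 hx.2))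
    (convex_Icc u v) ⟨hub', hb'v⟩ ⟨hub, hbv⟩
  rw [Real.norm_eq_abs, Real.norm_eq_abs] at hMVT
  exact hMVT

/-- **The rung in the exact window shape of the stub `DefectLipschitzSC`** (line `lipschitz-chain`): for every compact coupling window
`[u, v] ⊂ [0, r_ρ)` a modulus `M > 0` and a threshold `L₁` with `|δᶜ_b(L) − δᶜ_{b'}(L)| ≤ M |b − b'|` for `L ≥ L₁`, `b, b' ∈ [u, v]`. -/
theorem defectLipschitz_strongCoupling (r : LatticeRep G) (u v : ℝ) (hu : 0 ≤ u) (huv : u ≤ v)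
    (hv : v < strongCouplingRadius r.ρ) :
    ∃ M : ℝ, ∃ L₁ : ℕ, 0 < M ∧ ∀ L : ℕ, L₁ ≤ L → ∀ b b' : ℝ, u ≤ b → b ≤ v → u ≤ b' → b' ≤ v →
      |coldDefect r.ρ b L - coldDefect r.ρ b' L| ≤ M * |b - b'| := by
  obtain ⟨L₁, -, h⟩ := coldDefect_lipschitz_strongCoupling r
  refine ⟨(1 + Real.exp 1) / (strongCouplingRadius r.ρ - v), L₁, ?_, fun L hL b b' h1 h2 h3 h4 =>
    h u v hu huv hv L hL b b' h1 h2 h3 h4⟩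
  have : 0 < strongCouplingRadius r.ρ - v := by linarith
  positivity

end Complex

end Summit.QuantumFields.YangMills.Cruxes.IR.CouplingAxis

end
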